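import Literature.Geometry.Kaehler.StrataNbhdDescent
import Literature.Geometry.Kaehler.CechDescentExactness
import HarnessLib

/-!
# The strata `∂∂̄`-cochain makes the ambient class exact near the configuration

Topic `Literature/Geometry/Kaehler`. Assembly of bricks [B] (`StrataDDbarDescent`), [C₂]
(`StrataNbhdDescent`) and [C₃] (`CechDescentExactness`) of the direct route to P. Deligne's
*Théorie de Hodge III*, Cor. 8.2.8 on the tree's compact Kähler carriers (programme recorded in
`Literature/AlgebraicGeometry/HodgeTheory/GysinKernelSplitRationalCore.lean`):

`StrataMaps.exists_nbhd_restr_mem_localExactForms`: for a strata system `T` over a compact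
manifold `M` with embeddings `emb_I` of compact strata such that `emb (P_J)` contains
`⋂_l emb (P_{J l})`, a smooth closed complex `(k+2)`-form `x` on `M`, and strata cochains `η`
with `d η_{(i)} = emb^* x`, `δ η_a + (-1)^{a+1} d η_{a+1} = 0`, `η_{k+1} = 0` in form degree `0`
(the output of the `∂∂̄`-descent of [B]), the form `x` is EXACT ON AN OPEN NEIGHBOURHOOD `Ω` of
`⋃_i emb (P_i)`.

Proof: [C₂] gives neighbourhoods `N n J ⊇ emb (P_J)` and ambient cochains `γ` with
`r x = D γ` near the strata; a uniform metric thickening `U_i` of the `emb (P_i)` (§1, Lebesgue-number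
type shrinking in the compact metrizable `M`) has all its finite intersections `U_J` inside the
`N n J`; [C₃] (Bott–Tu (1982), Prop. 8.8 on `⋃ U_i`) concludes. Everything is proved; no named
facts (D-0026).

## References

* R. Bott, L. W. Tu, *Differential Forms in Algebraic Topology*, Springer GTM 82 (1982), §8,
  Prop. 8.8. [BottTu1982Forms]
* P. Deligne, *Théorie de Hodge III*, Publ. Math. IHÉS 44 (1974), 8.2.7–8.2.8. [DeligneHodgeIII1974]
* P. Deligne, Ph. Griffiths, J. Morgan, D. Sullivan, *Real homotopy theory of Kähler manifolds*,
  Invent. Math. 29 (1975), §5–§6. [DeligneGriffithsMorganSullivan1975]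
-/

noncomputable section

open scoped Manifold ContDiff Topology
open Set Function Finset Literature.NumberTheory.Transcendental Literature.Geometry.Manifold
open _root_.Topology

universe u

namespace Literature.Geometry.Kaehler

set_option backward.isDefEq.respectTransparency false

/-! ### §1 Uniform shrinking of finitely many compact sets into given neighbourhoods -/

section Shrink

variable {X : Type*} [MetricSpace X] [CompactSpace X]

/-- **Lebesgue-number type shrinking**: if the intersection of finitely many compact sets lies in
an open set `O`, so does the intersection of their `ε`-thickenings for some `ε > 0`. [folklore] -/
theorem exists_pos_iInter_thickening_subset {m : ℕ} (A : Fin m → Set X) (hA : ∀ l, IsCompact (A l))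
    {O : Set X} (hO : IsOpen O) (h : (⋂ l, A l) ⊆ O) :
    ∃ ε > (0 : ℝ), (⋂ l, Metric.thickening ε (A l)) ⊆ O := by
  classical
  by_cases hne : ∀ l, (A l).Nonempty
  swap
  · simp only [not_forall, Set.not_nonempty_iff_eq_empty] at hne
    obtain ⟨l, hl⟩ := hne
    refine ⟨1, one_pos, fun y hy ↦ ?_⟩
    have := Set.mem_iInter.1 hy l
    rw [hl, Metric.thickening_empty] at this
    exact this.elim
  rcases Nat.eq_zero_or_pos m with rfl | hm
  · exact ⟨1, one_pos, fun y _ ↦ h (Set.mem_iInter.2 fun l ↦ l.elim0)⟩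
  -- the gauge `g y = Σ_l dist(y, A_l)`
  set g : X → ℝ := fun y ↦ ∑ l, Metric.infDist y (A l) with hg
  have hgc : Continuous g := continuous_finsetSum _ fun l _ ↦ Metric.continuous_infDist_pt (A l)
  have hg0 : ∀ y, g y = 0 → y ∈ O := by
    intro y hy
    have hl : ∀ l, Metric.infDist y (A l) = 0 := fun l ↦
      (Finset.sum_eq_zero_iff_of_nonneg fun l _ ↦ Metric.infDist_nonneg).1 hy l (Finset.mem_univ l)
    refine h (Set.mem_iInter.2 fun l ↦ ?_)
    rw [← (hA l).isClosed.closure_eq, Metric.mem_closure_iff_infDist_zero (hne l)]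
    exact hl l
  by_cases hC : (Oᶜ : Set X).Nonempty
  swap
  · rw [Set.not_nonempty_iff_eq_empty, Set.compl_empty_iff] at hC
    exact ⟨1, one_pos, hC ▸ Set.subset_univ _⟩
  obtain ⟨y₀, hy₀C, hy₀⟩ := hO.isClosed_compl.isCompact.exists_isMinOn hC hgc.continuousOn
  have hε₀ : 0 < g y₀ := by
    rcases (Finset.sum_nonneg fun l _ ↦ Metric.infDist_nonneg : 0 ≤ g y₀).eq_or_lt with h0 | h0
    · exact (hy₀C (hg0 y₀ h0.symm)).elim
    · exact h0
  refine ⟨g y₀ / m, div_pos hε₀ (Nat.cast_pos.2 hm), fun y hy ↦ ?_⟩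
  by_contra hyO
  have hle : g y₀ ≤ g y := hy₀ hyO
  have hlt : g y < g y₀ := by
    calc g y = ∑ l, Metric.infDist y (A l) := rfl
      _ < ∑ _l : Fin m, g y₀ / m := by
          refine Finset.sum_lt_sum_of_nonempty (Finset.univ_nonempty_iff.2 ⟨⟨0, hm⟩⟩) fun l _ ↦ ?_
          exact (Metric.mem_thickening_iff_infDist_lt (hne l)).1 (Set.mem_iInter.1 hy l)
      _ = g y₀ := by
          rw [Finset.sum_const, Finset.card_univ, Fintype.card_fin, nsmul_eq_mul]
          field_simp
  exact absurd hle (not_le.2 hlt)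

omit [CompactSpace X] in
/-- A uniform positive `ε` for finitely many requirements, each satisfied by all small enough
`ε > 0`. [folklore] -/
theorem exists_pos_forall_of_finite {C : Type*} [Finite C] (Q : C → ℝ → Prop)
    (hQ : ∀ c ε ε', 0 < ε' → ε' ≤ ε → Q c ε → Q c ε') (h : ∀ c, ∃ ε > (0 : ℝ), Q c ε) :
    ∃ ε > (0 : ℝ), ∀ c, Q c ε := by
  classical
  haveI := Fintype.ofFinite C
  choose ε hε hQε using h
  rcases isEmpty_or_nonempty C with hC | hC
  · exact ⟨1, one_pos, fun c ↦ (hC.false c).elim⟩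
  have hne : (Finset.univ : Finset C).Nonempty := Finset.univ_nonempty
  refine ⟨Finset.univ.inf' hne ε, (Finset.lt_inf'_iff hne).2 fun c _ ↦ hε c, fun c ↦ ?_⟩
  exact hQ c (ε c) _ ((Finset.lt_inf'_iff hne).2 fun c _ ↦ hε c) (Finset.inf'_le _ (Finset.mem_univ c))
    (hQε c)

end Shrink

/-! ### §2 The assembly -/

section Assembly

variable {ι : Type} [Fintype ι] [DecidableEq ι]
  {EM : Type u} [NormedAddCommGroup EM] [NormedSpace ℂ EM] [FiniteDimensional ℂ EM]
  {M : Type u} [TopologicalSpace M] [ChartedSpace EM M] [IsManifold 𝓘(ℝ, EM) ∞ M]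
  [CompactSpace M] [T2Space M] [SecondCountableTopology M]
  {EP : Finset ι → Type u} [∀ I, NormedAddCommGroup (EP I)] [∀ I, NormedSpace ℂ (EP I)]
  [∀ I, FiniteDimensional ℂ (EP I)]
  {P : Finset ι → Type u} [∀ I, TopologicalSpace (P I)] [∀ I, ChartedSpace (EP I) (P I)]
  [∀ I, IsManifold 𝓘(ℝ, EP I) ∞ (P I)] [∀ I, CompactSpace (P I)] [∀ I, T2Space (P I)]
  [∀ I, SecondCountableTopology (P I)]

omit [FiniteDimensional ℂ EM] in
/-- Real scalars act on complex alternating maps through `ℝ → ℂ`. [folklore] -/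
theorem real_smul_eq_complex_smul_calt {b : ℕ} (r : ℝ) (φ : EM [⋀^Fin b]→L[ℝ] ℂ) :
    r • φ = (r : ℂ) • φ := by
  ext v; simp

/-- **The ambient class is exact near the configuration** (Deligne–Griffiths–Morgan–Sullivan
(1975), §5–§6 with Bott–Tu (1982), Prop. 8.8): given the strata `∂∂̄`-cochain `η` of the smooth
closed complex `(k+2)`-form `x` (`d η_{(i)} = emb^* x`, `δ η_a + (-1)^{a+1} d η_{a+1} = 0` on
`a + b = k`, `η_{k+1} = 0` in form degree `0`) for a strata system with embeddings of compact
strata into the compact manifold `M` such that `⋂_l emb (P_{J l}) ⊆ emb (P_J)`, the form `x` is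
exact on an open neighbourhood of `⋃_i emb (P_i)`.
[cite: DeligneGriffithsMorganSullivan1975, §5–§6] [cite: BottTu1982Forms, §8, Prop. 8.8] -/
theorem StrataMaps.exists_nbhd_restr_mem_localExactForms (T : StrataMaps (EM := EM) M EP P)
    (hTe : ∀ I, IsEmbedding (T.emb I))
    (hTr : ∀ {n : ℕ} (J : Fin (n + 1) → ι),
      (⋂ l, Set.range (T.emb {J l})) ⊆ Set.range (T.emb (tupleSupport J)))
    {k : ℕ} {x₀ : MForm 𝓘(ℝ, EM) M ℂ (k + 2)} (hx₀ : x₀ ∈ closedSmoothForms 𝓘(ℝ, EM) M ℂ (k + 2))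
    (η : (a b : ℕ) → SCochain EP P a b) (hηs : ∀ a b J, IsSmoothForm (η a b J))
    (hη0 : ∀ J : Fin 1 → ι, mextDeriv (η 0 (k + 1) J) = T.sres x₀ J)
    (hηE : ∀ a b, a + b = k → ∀ J : Fin (a + 2) → ι,
      T.delta (η a (b + 1)) J + (-1 : ℂ) ^ (a + 1) • mextDeriv (η (a + 1) b J) = 0)
    (hηz : ∀ J : Fin (k + 2) → ι, η (k + 1) 0 J = 0) :
    ∃ (Ω : Set M) (hΩ : IsOpen Ω), (⋃ i, Set.range (T.emb {i})) ⊆ Ω ∧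
      x₀.restr Ω ∈ localExactForms 𝓘(ℝ, EM) ℂ hΩ (k + 2) := by
  classical
  haveI : FiniteDimensional ℝ EM := FiniteDimensional.complexToReal EM
  letI : MetricSpace M := TopologicalSpace.metrizableSpaceMetric M
  -- the family of forms, junk off degree `k + 2`
  let x : (q : ℕ) → MForm 𝓘(ℝ, EM) M ℂ q := fun q ↦ if h : q = k + 2 then h ▸ x₀ else 0
  have hxq : x (k + 2) = x₀ := by simp [x]
  obtain ⟨N, γ, V, hNo, hNe, -, hγs, hE0, hE, hL⟩ :=
    StrataMaps.exists_nbhd_descent (T := T) (η := η) (x := x) hTe hηs hηE (by rw [hxq]; exact hx₀)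
      (by intro J; rw [hxq]; exact hη0 J) hηz
  -- the compact images and the requirements on `ε`
  set K : ι → Set M := fun i ↦ Set.range (T.emb {i}) with hK
  have hKc : ∀ i, IsCompact (K i) := fun i ↦ isCompact_range (T.contMDiff_emb _).continuous
  have hKJ : ∀ {n : ℕ} (J : Fin (n + 1) → ι) (S : Set M),
      (∀ y, T.emb (tupleSupport J) y ∈ S) → (⋂ l, K (J l)) ⊆ S := by
    intro n J S hS
    refine (hTr J).trans ?_
    rintro _ ⟨y, rfl⟩
    exact hS y
  let C : Type := (Σ n : Fin (k + 2), (Fin (n + 1) → ι)) ⊕ (Fin (k + 3) → ι)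
  let Q : C → ℝ → Prop := fun c ε ↦ match c with
    | Sum.inl ⟨n, J⟩ => (⋂ l, Metric.thickening ε (K (J l))) ⊆ N n J
    | Sum.inr J => (⋂ l, Metric.thickening ε (K (J l))) ⊆ V J
  have hQmono : ∀ c ε ε', 0 < ε' → ε' ≤ ε → Q c ε → Q c ε' := by
    rintro (⟨n, J⟩ | J) ε ε' - hle hQ
    · exact (Set.iInter_mono fun l ↦ Metric.thickening_mono hle _).trans hQ
    · exact (Set.iInter_mono fun l ↦ Metric.thickening_mono hle _).trans hQ
  have hQex : ∀ c, ∃ ε > (0 : ℝ), Q c ε := by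
    rintro (⟨n, J⟩ | J)
    · exact exists_pos_iInter_thickening_subset _ (fun l ↦ hKc _) (hNo n J) (hKJ J _ (hNe n J))
    · exact exists_pos_iInter_thickening_subset _ (fun l ↦ hKc _) (hL J).1 (hKJ J _ (hL J).2.2.1)
  obtain ⟨ε, hε, hQε⟩ := exists_pos_forall_of_finite Q hQmono hQex
  -- the thickened cover
  let U : ι → Set M := fun i ↦ Metric.thickening ε (K i)
  have hU : ∀ i, IsOpen (U i) := fun i ↦ Metric.isOpen_thickening
  have hcU : ∀ {n : ℕ} (J : Fin (n + 1) → ι), cechSet U J = ⋂ l, Metric.thickening ε (K (J l)) :=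
    fun J ↦ rfl
  have hUN : ∀ n b, n + b = k + 1 → ∀ J : Fin (n + 1) → ι, cechSet U J ⊆ N n J := by
    intro n b h J
    rw [hcU]
    exact hQε (Sum.inl ⟨⟨n, by omega⟩, J⟩)
  have hUV : ∀ J : Fin (k + 3) → ι, cechSet U J ⊆ V J := fun J ↦ hQε (Sum.inr J)
  refine ⟨⋃ i, U i, isOpen_iUnion hU,
    Set.iUnion_mono fun i ↦ Metric.self_subset_thickening hε _, ?_⟩
  have hsm : ∀ (r : ℝ) {b : ℕ} (φ : EM [⋀^Fin b]→L[ℝ] ℂ), r • φ = (r : ℂ) • φ :=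
    fun r b φ ↦ real_smul_eq_complex_smul_calt r φ
  refine restr_mem_localExactForms_of_cechDescent hU (fun y _ ↦ (isSmoothForm_iff_smoothAt _).1 hx₀.1 y)
    γ ?_ ?_ ?_ ?_
  · intro n b h J y hy
    exact (hγs n b (by omega) J).1 y (hUN n b h J hy)
  · intro J y hy
    rw [hE0 J y (hUN 0 (k + 1) (by omega) J hy), hxq]
  · intro n b h J y hy
    have hyN : y ∈ N (n + 1) J := hUN (n + 1) b h J hy
    have h1 := congrFun (hE n b h J) y
    rw [Pi.add_apply, Pi.smul_apply, Pi.zero_apply, cdelta_apply_of_mem _ J hyN,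
      MForm.restr_apply_of_mem _ hyN] at h1
    simp only [hsm, Complex.ofReal_pow, Complex.ofReal_neg, Complex.ofReal_one]
    exact h1
  · intro J y hy
    have h1 := congrFun (hL J).2.2.2 y
    rw [Pi.zero_apply, cdelta_apply_of_mem _ J (hUV J hy)] at h1
    simp only [hsm, Complex.ofReal_pow, Complex.ofReal_neg, Complex.ofReal_one]
    exact h1

end Assembly

end Literature.Geometry.Kaehler

end
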